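import Summits.AtomisticToContinuum.HydrodynamicLimit.Theorems.StiffCollisionalRelaxationAprioriBoundsFibreDeficitSliceGibbs
import Summits.AtomisticToContinuum.HydrodynamicLimit.Theorems.StiffCollisionalRelaxationAprioriBoundsFibreDeficitSlabBounds
import Summits.AtomisticToContinuum.HydrodynamicLimit.Theorems.StiffCollisionalRelaxationAprioriBoundsFibreLinStatL1Fields
import HarnessLib

/-!
# The lever `stub_deficitTransfer` of the line `fibre-deficit-transfer` (crux `AprioriBounds`,
stmt-AtomisticToContinuum-14827), part 2: the relative entropy against the tilted reference is sub-extensive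

Support file (`--supports stmt-AtomisticToContinuum-14827`) of the lead prover of the line.  Part 1
(`…FibreDeficitSliceGibbs`) proved the identity `H(μ_s | G_s) = log Z − S(μ₀) − (N+1)m_s − (N+1)E_{μ₀}[ℓ_s ∘ Φ_s]` and,
under the statics bound `TiltedExcessAt`, `H(μ_s | G_s) ≤ C(N+1)^{1−c} − (N+1)E_{μ₀}[ℓ_s ∘ Φ_s]`.  This part bounds the
mean of the linear statistic: `E_{μ₀}|ℓ_s ∘ Φ_s| ≤ C_*(N+1)^{−a₂}`, `a₂ = min(b, p, 1)`, from the rated input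
`LinearHydroRateAt` (`|ℓ_s| ≤ (N+1)^{−b}` off an event of probability `(N+1)^{−p}`) and the exponential energy moment
`EnergyMomentAt` — WITHOUT Cauchy–Schwarz: on the bad event `|ℓ_s ∘ Φ_s| ≤ A₁ + (2/θ_min)·E/(N+1)` (uniform bounds of
the tilt fields on the compact slab, part 2a `…FibreDeficitSlabBounds`; energy conservation), and the energy above the level `m = 2/κ²` is
paid by the exponential moment (`x ≤ eˣ`, `e^{−(N+1)/κ}`).  Consequence (registered sub-goal of this file):

  `klDiv_lawAt_slice_le_pow` — `∃ a₁ > 0, C₁, N₀: ∀ N ≥ N₀, ∀ s ≤ t, H(μ_s | G_s) ≤ C₁ (N+1)^{1−a₁}`.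
-/

noncomputable section

open MeasureTheory Filter Set Topology InformationTheory
open scoped ENNReal

namespace Summit.AtomisticToContinuum.HydrodynamicLimit.Theorems.FibreDeficitTransfer

open Literature.MathematicalPhysics.KineticTheory Literature.Analysis.FluidPDE
open Summit.AtomisticToContinuum.HydrodynamicLimit.Theorems.VisitLedgerUpscattering (Cfg Flow Flows NiceProfiles)
open MacroClosureLine.StubLedger JaynesSqueezeClosure JaynesSqueezeSqueeze

variable {σ : ℝ} {ρ θ : ℝ → T3 → ℝ} {u : ℝ → T3 → V3} {t : ℝ}

/-! ## The exponential-Markov step -/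

/-- **The mean of `|ℓ_s ∘ Φ_s|` under the local Gibbs law** from the rate event and the exponential energy moment:
`E|ℓ_s ∘ Φ_s| ≤ β + (A₁ + D m)·P(bad) + D e^{m} e^{−(N+1)/κ}` at the level `m = 2/κ²` (energy conservation a.e.). -/
theorem integral_abs_linStat_flow_le {a₀ θ₀ : T3 → ℝ} {u₀ : T3 → V3} (hP : NiceProfiles a₀ θ₀ u₀) (hσ2 : σ ≤ 1 / 2)
    {N : ℕ} (Φ : Flow σ N) {s A₁ D κ β q : ℝ} (hA₁ : 0 ≤ A₁) (hD : 0 ≤ D) (hκ : 0 < κ)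
    (hκN : 1 ≤ κ * ((N : ℝ) + 1)) (hβ : 0 ≤ β) (hq : 0 ≤ q)
    (hℓ : ∀ w : Cfg N, |linStat σ ρ θ u s w| ≤ A₁ + D * (configEnergy w / ((N : ℝ) + 1)))
    (hmeas : Measurable fun w : Cfg N => linStat σ ρ θ u s w)
    (hint : Integrable (fun z => linStat σ ρ θ u s (Φ.flow s z)) (localGibbsLaw σ a₀ u₀ θ₀ N Φ))
    (hbad : localGibbsLaw σ a₀ u₀ θ₀ N Φ {z | β < |linStat σ ρ θ u s (Φ.flow s z)|} ≤ ENNReal.ofReal q)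
    (hmom : ∫⁻ z, ENNReal.ofReal (Real.exp (κ * configEnergy z)) ∂(localGibbsLaw σ a₀ u₀ θ₀ N Φ) ≤
      ENNReal.ofReal (Real.exp (((N : ℝ) + 1) / κ))) :
    ∫ z, |linStat σ ρ θ u s (Φ.flow s z)| ∂(localGibbsLaw σ a₀ u₀ θ₀ N Φ) ≤
      β + (A₁ + D * (2 / κ ^ 2)) * q + D * (Real.exp (2 / κ ^ 2) * Real.exp (-(((N : ℝ) + 1) / κ))) := by
  obtain ⟨ha, hθ₀, hu₀, ha0, hθ0⟩ := hP
  haveI := isProbabilityMeasure_localGibbsLaw ha hθ₀ hu₀ ha0 hθ0 hσ2 N Φ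
  set P := localGibbsLaw σ a₀ u₀ θ₀ N Φ with hPdef
  set m : ℝ := 2 / κ ^ 2 with hm_def
  have hm : 0 ≤ m := by positivity
  set B : Set (Cfg N) := {z | β < |linStat σ ρ θ u s (Φ.flow s z)|} with hB
  have hBm : MeasurableSet B := measurableSet_lt measurable_const ((hmeas.comp (Φ.measurable_flow s)).abs)
  set c : ℝ := Real.exp (-((κ * ((N : ℝ) + 1) - 1) * m)) with hc
  -- pass to the lower integral
  have hnn : 0 ≤ᵐ[P] fun z => |linStat σ ρ θ u s (Φ.flow s z)| := ae_of_all _ fun z => abs_nonneg _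
  rw [integral_eq_lintegral_of_nonneg_ae hnn hint.abs.aestronglyMeasurable]
  -- pointwise bound, integrated
  have hpt := fun z => LinStatL1.abs_linStat_flow_le_split Φ (β := β) (κ := κ) hD hm hβ hκN hℓ z
  have hEm : Measurable fun z : Cfg N => ENNReal.ofReal (Real.exp (κ * configEnergy (Φ.flow s z))) := by
    have h : Measurable fun w : Cfg N => configEnergy w := by
      unfold configEnergy
      exact measurable_const.mul (Finset.measurable_sum _ fun i _ => (measurable_pi_apply i).snd.norm.pow_const 2)
    exact ((h.comp (Φ.measurable_flow s)).const_mul κ).exp.ennreal_ofReal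
  have hle : ∫⁻ z, ENNReal.ofReal |linStat σ ρ θ u s (Φ.flow s z)| ∂P ≤
      ENNReal.ofReal β + ENNReal.ofReal (A₁ + D * m) * P B +
        ENNReal.ofReal (D * c) * ∫⁻ z, ENNReal.ofReal (Real.exp (κ * configEnergy (Φ.flow s z))) ∂P := by
    calc ∫⁻ z, ENNReal.ofReal |linStat σ ρ θ u s (Φ.flow s z)| ∂P
        ≤ ∫⁻ z, ENNReal.ofReal β + ENNReal.ofReal (A₁ + D * m) * B.indicator 1 z +
            ENNReal.ofReal (D * c) * ENNReal.ofReal (Real.exp (κ * configEnergy (Φ.flow s z))) ∂P := by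
          refine lintegral_mono fun z => ?_
          have h := hpt z
          have h1 : (0 : ℝ) ≤ (A₁ + D * m) * B.indicator 1 z := by
            refine mul_nonneg (by positivity) (Set.indicator_nonneg (fun _ _ => zero_le_one) _)
          have h2 : (0 : ℝ) ≤ D * (c * Real.exp (κ * configEnergy (Φ.flow s z))) := by positivity
          calc ENNReal.ofReal |linStat σ ρ θ u s (Φ.flow s z)|
              ≤ ENNReal.ofReal (β + (A₁ + D * m) * B.indicator 1 z + D * (c * Real.exp (κ * configEnergy (Φ.flow s z)))) :=
                ENNReal.ofReal_le_ofReal h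
            _ = ENNReal.ofReal β + ENNReal.ofReal ((A₁ + D * m) * B.indicator 1 z) +
                  ENNReal.ofReal (D * (c * Real.exp (κ * configEnergy (Φ.flow s z)))) := by
                rw [ENNReal.ofReal_add (by positivity) h2, ENNReal.ofReal_add hβ h1]
            _ = _ := by
                congr 1
                · congr 1
                  rw [ENNReal.ofReal_mul (by positivity)]
                  congr 1
                  by_cases hz : z ∈ B
                  · simp [indicator_of_mem hz]
                  · simp [indicator_of_notMem hz]
                · rw [← mul_assoc, ENNReal.ofReal_mul (by positivity)]
      _ = ENNReal.ofReal β + ENNReal.ofReal (A₁ + D * m) * P B +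
            ENNReal.ofReal (D * c) * ∫⁻ z, ENNReal.ofReal (Real.exp (κ * configEnergy (Φ.flow s z))) ∂P := by
          have hm1 : Measurable fun z : Cfg N => ENNReal.ofReal β + ENNReal.ofReal (A₁ + D * m) * B.indicator 1 z :=
            Measurable.const_add (Measurable.const_mul (measurable_one.indicator hBm) _) _
          rw [lintegral_add_left hm1, lintegral_add_left measurable_const, lintegral_const, measure_univ, mul_one,
            lintegral_const_mul _ (measurable_one.indicator hBm), lintegral_indicator_one hBm,
            lintegral_const_mul _ hEm]
  -- energy conservation a.e.: the moment through the flow is the time-zero moment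
  have hgood : ∀ᵐ z ∂P, z ∈ Φ.good := by
    have hac : P ≪ liouville (Torus.geometry (Fin 3)) (N + 1) (hsDiameter σ N) := by
      rw [hPdef, localGibbsLaw, particleLaw_eq]; exact withDensity_absolutelyContinuous _ _
    exact hac.ae_le Φ.ae_mem_good
  have hflowmom : ∫⁻ z, ENNReal.ofReal (Real.exp (κ * configEnergy (Φ.flow s z))) ∂P =
      ∫⁻ z, ENNReal.ofReal (Real.exp (κ * configEnergy z)) ∂P := by
    refine lintegral_congr_ae ?_
    filter_upwards [hgood] with z hz
    rw [Φ.configEnergy_flow hz s]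
  rw [hflowmom] at hle
  -- numerical values: `c · e^{(N+1)/κ} = e^{m} e^{−(N+1)/κ}` at `m = 2/κ²`
  have hcexp : c * Real.exp (((N : ℝ) + 1) / κ) = Real.exp m * Real.exp (-(((N : ℝ) + 1) / κ)) := by
    rw [hc, ← Real.exp_add, ← Real.exp_add]
    congr 1
    rw [hm_def]
    field_simp
    ring
  have hfin : ENNReal.ofReal β + ENNReal.ofReal (A₁ + D * m) * P B +
      ENNReal.ofReal (D * c) * ∫⁻ z, ENNReal.ofReal (Real.exp (κ * configEnergy z)) ∂P ≤
      ENNReal.ofReal (β + (A₁ + D * m) * q + D * (Real.exp m * Real.exp (-(((N : ℝ) + 1) / κ)))) := by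
    have hADm : 0 ≤ A₁ + D * m := add_nonneg hA₁ (mul_nonneg hD hm)
    have e1 : ENNReal.ofReal (β + (A₁ + D * m) * q + D * (Real.exp m * Real.exp (-(((N : ℝ) + 1) / κ)))) =
        ENNReal.ofReal β + ENNReal.ofReal ((A₁ + D * m) * q) +
          ENNReal.ofReal (D * (Real.exp m * Real.exp (-(((N : ℝ) + 1) / κ)))) := by
      rw [ENNReal.ofReal_add (add_nonneg hβ (mul_nonneg hADm hq)) (mul_nonneg hD (by positivity)),
        ENNReal.ofReal_add hβ (mul_nonneg hADm hq)]
    rw [e1]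
    refine add_le_add (add_le_add le_rfl ?_) ?_
    · rw [ENNReal.ofReal_mul hADm]
      exact mul_le_mul_right hbad _
    · calc ENNReal.ofReal (D * c) * ∫⁻ z, ENNReal.ofReal (Real.exp (κ * configEnergy z)) ∂P
          ≤ ENNReal.ofReal (D * c) * ENNReal.ofReal (Real.exp (((N : ℝ) + 1) / κ)) := mul_le_mul_right hmom _
        _ = ENNReal.ofReal (D * (Real.exp m * Real.exp (-(((N : ℝ) + 1) / κ)))) := by
            rw [← ENNReal.ofReal_mul (mul_nonneg hD (Real.exp_pos _).le), mul_assoc, hcexp]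
  have hlt : ∫⁻ z, ENNReal.ofReal |linStat σ ρ θ u s (Φ.flow s z)| ∂P < ⊤ :=
    lt_of_le_of_lt (hle.trans hfin) ENNReal.ofReal_lt_top
  have _ := hlt
  exact ENNReal.toReal_le_of_le_ofReal (by positivity) (hle.trans hfin)

/-! ## Sub-extensivity of the relative entropy -/

/-- **`H(μ_s | G_s)` is sub-extensive** (registered sub-goal of this file): under the hypotheses of the lever there are
`a₁ > 0`, `C₁` and `N₀` with `H(μ_s | G_s) ≤ C₁ (N+1)^{1−a₁}` for all `N ≥ N₀` and `s ∈ [0, t]`, where `G_s` is the local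
Gibbs law of the slice profile. -/
theorem klDiv_lawAt_slice_le_pow : ∀ (σ : ℝ) (a₀ θ₀ : T3 → ℝ) (u₀ : T3 → V3) (ρ θ : ℝ → T3 → ℝ) (u : ℝ → T3 → V3) (Φ : (N : ℕ) → HardSphereFlow (Torus.geometry (Fin 3)) (hsDiameter σ N) (N + 1)) (t : ℝ), 0 < σ → σ < 1 / 2 → NiceProfiles a₀ θ₀ u₀ → 0 < t → ContinuousOn (Function.uncurry ρ) (Icc 0 t ×ˢ univ) → ContinuousOn (Function.uncurry θ) (Icc 0 t ×ˢ univ) → ContinuousOn (Function.uncurry u) (Icc 0 t ×ˢ univ) → (∀ s ∈ Icc 0 t, ∀ x, 0 < θ s x) → ContinuousOn (fun p : ℝ × T3 => lam0 σ (ρ p.1 p.2) (θ p.1 p.2) (u p.1 p.2)) (Icc 0 t ×ˢ univ) → LinearHydroRateAt σ a₀ θ₀ u₀ ρ θ u Φ t → TiltedExcessAt σ a₀ θ₀ u₀ ρ θ u t → EnergyMomentAt σ a₀ θ₀ u₀ Φ → ∃ a₁ C₁ : ℝ, 0 < a₁ ∧ ∃ N₀ : ℕ, ∀ N : ℕ,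 N₀ ≤ N → ∀ s ∈ Icc 0 t, (klDiv ((Φ N).lawAt (localGibbsLaw σ a₀ u₀ θ₀ N (Φ N)) s) (localGibbsLaw σ (fun x => Real.exp (lam0 σ (ρ s x) (θ s x) (u s x) + ‖u s x‖ ^ 2 / (2 * θ s x)) * (2 * Real.pi * θ s x) ^ ((3 : ℝ) / 2)) (u s) (θ s) N (Φ N))).toReal ≤ C₁ * ((N : ℝ) + 1) ^ (1 - a₁) := by
  intro σ a₀ θ₀ u₀ ρ θ u Φ t hσ hσ2 hP ht hρc hθc huc hθ hΛ hRate hExc hMom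
  obtain ⟨b, p, hb, hp, N₁, hrate⟩ := hRate
  obtain ⟨c, C, hc, N₂, hexc⟩ := hExc
  obtain ⟨κ, hκ, hmom⟩ := hMom
  obtain ⟨A₁, D, hA₁, hD, hℓ⟩ := exists_abs_linStat_le σ ρ θ u t hρc hθc huc ht.le hθ hΛ
  -- exponents and constants
  set a₂ : ℝ := min (min b p) 1 with ha₂
  have ha₂pos : 0 < a₂ := lt_min (lt_min hb hp) one_pos
  set a₁ : ℝ := min a₂ c with ha₁
  have ha₁pos : 0 < a₁ := lt_min ha₂pos hc
  set m : ℝ := 2 / κ ^ 2 with hm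
  set K : ℝ := 1 + (A₁ + D * m) + D * (Real.exp m * κ) with hK
  have hK0 : 0 ≤ K := by positivity
  -- `N₀`: beyond the two thresholds and with `κ (N+1) ≥ 1`
  obtain ⟨N₃, hN₃⟩ := exists_nat_ge (1 / κ)
  refine ⟨a₁, max C 0 + K, ha₁pos, max (max N₁ N₂) N₃, fun N hN s hs => ?_⟩
  have hN1 : N₁ ≤ N := le_trans (le_max_left _ _) ((le_max_left _ _).trans hN)
  have hN2 : N₂ ≤ N := le_trans (le_max_right _ _) ((le_max_left _ _).trans hN)
  have hN3 : N₃ ≤ N := (le_max_right _ _).trans hN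
  have hNpos : (0 : ℝ) < (N : ℝ) + 1 := by positivity
  have hN1' : (1 : ℝ) ≤ (N : ℝ) + 1 := by linarith [(Nat.cast_nonneg N : (0 : ℝ) ≤ N)]
  have hκN : 1 ≤ κ * ((N : ℝ) + 1) := by
    have h1 : 1 / κ ≤ (N : ℝ) := hN₃.trans (by exact_mod_cast hN3)
    rw [div_le_iff₀ hκ] at h1
    nlinarith
  -- slice hypotheses
  have hθs : Continuous (θ s) := continuous_slice hθc hs
  have hus : Continuous (u s) := continuous_slice huc hs
  have hθpos : ∀ x, 0 < θ s x := hθ s hs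
  have hΛs : Continuous fun x => lam0 σ (ρ s x) (θ s x) (u s x) :=
    continuous_slice (f := fun s x => lam0 σ (ρ s x) (θ s x) (u s x)) hΛ hs
  -- part 1: `H ≤ C (N+1)^{1-c} − (N+1) E[ℓ ∘ Φ_s]`
  have h1 := toReal_klDiv_lawAt_slice_le σ a₀ θ₀ u₀ ρ θ u N (Φ N) s (C * ((N : ℝ) + 1) ^ (1 - c)) hσ hσ2 hP hθs hus
    hθpos hΛs (hexc N hN2 s hs)
  -- the mean of `|ℓ ∘ Φ_s|`
  have hmeas : Measurable fun w : Cfg N => linStat σ ρ θ u s w := by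
    have h : (fun w : Cfg N => linStat σ ρ θ u s w) =
        fun w => ((N + 1 : ℕ) : ℝ)⁻¹ * (∑ i, tiltExponent σ ρ θ u s (w i)) - tiltMean σ ρ θ u s := by
      funext w; rw [linStat_eq, tiltPot]
    rw [h]
    refine (measurable_const.mul (Finset.measurable_sum _ fun i _ => ?_)).sub measurable_const
    have hcont : Continuous fun y : T3 × V3 => tiltExponent σ ρ θ u s y := by
      unfold tiltExponent
      exact ((hΛs.comp continuous_fst).add (((hus.comp continuous_fst).inner continuous_snd).div
        (hθs.comp continuous_fst) fun y => (hθpos y.1).ne')).sub ((continuous_snd.norm.pow 2).div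
        (continuous_const.mul (hθs.comp continuous_fst)) fun y => mul_ne_zero two_ne_zero (hθpos y.1).ne')
    exact hcont.measurable.comp (measurable_pi_apply i)
  have hint : Integrable (fun z => linStat σ ρ θ u s ((Φ N).flow s z)) (localGibbsLaw σ a₀ u₀ θ₀ N (Φ N)) :=
    integrable_linStat_flow hP.1 hP.2.1 hP.2.2.1 hP.2.2.2.1 hP.2.2.2.2 hσ2.le N (Φ N) s hθs hus hθpos hΛs
  have h2 := integral_abs_linStat_flow_le hP hσ2.le (Φ N) (s := s) (β := ((N : ℝ) + 1) ^ (-b))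
    (q := ((N : ℝ) + 1) ^ (-p)) hA₁ hD.le hκ hκN (Real.rpow_nonneg hNpos.le _) (Real.rpow_nonneg hNpos.le _)
    (hℓ s hs N) hmeas hint (hrate N hN1 s hs) (hmom N)
  -- `−E[ℓ∘Φ] ≤ E|ℓ∘Φ|`
  have h3 : -(∫ z, linStat σ ρ θ u s ((Φ N).flow s z) ∂(localGibbsLaw σ a₀ u₀ θ₀ N (Φ N))) ≤
      ∫ z, |linStat σ ρ θ u s ((Φ N).flow s z)| ∂(localGibbsLaw σ a₀ u₀ θ₀ N (Φ N)) := by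
    rw [← integral_neg]
    exact integral_mono hint.neg hint.abs fun z => neg_le_abs _
  -- polynomial bookkeeping: every term of `h2` is `≤ (N+1)^{-a₂}`
  have hpow : ∀ x : ℝ, a₂ ≤ x → ((N : ℝ) + 1) ^ (-x) ≤ ((N : ℝ) + 1) ^ (-a₂) := fun x hx =>
    Real.rpow_le_rpow_of_exponent_le hN1' (neg_le_neg hx)
  have hb' : ((N : ℝ) + 1) ^ (-b) ≤ ((N : ℝ) + 1) ^ (-a₂) := hpow b ((min_le_left _ _).trans (min_le_left _ _))
  have hp' : ((N : ℝ) + 1) ^ (-p) ≤ ((N : ℝ) + 1) ^ (-a₂) := hpow p ((min_le_left _ _).trans (min_le_right _ _))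
  have hexp' : Real.exp (-(((N : ℝ) + 1) / κ)) ≤ κ * ((N : ℝ) + 1) ^ (-a₂) := by
    -- `e^{-y} ≤ 1/y` with `y = (N+1)/κ`, and `(N+1)^{-1} ≤ (N+1)^{-a₂}`
    have hy : 0 < ((N : ℝ) + 1) / κ := by positivity
    have h1 : Real.exp (-(((N : ℝ) + 1) / κ)) ≤ 1 / (((N : ℝ) + 1) / κ) := by
      rw [Real.exp_neg, one_div]
      exact inv_anti₀ hy (by linarith [Real.add_one_le_exp (((N : ℝ) + 1) / κ)])
    have h2 : 1 / (((N : ℝ) + 1) / κ) = κ * ((N : ℝ) + 1) ^ (-(1 : ℝ)) := by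
      rw [Real.rpow_neg hNpos.le, Real.rpow_one]; field_simp
    rw [h2] at h1
    exact h1.trans (mul_le_mul_of_nonneg_left (hpow 1 (min_le_right _ _)) hκ.le)
  have hmean : ∫ z, |linStat σ ρ θ u s ((Φ N).flow s z)| ∂(localGibbsLaw σ a₀ u₀ θ₀ N (Φ N)) ≤
      K * ((N : ℝ) + 1) ^ (-a₂) := by
    refine h2.trans ?_
    have hq0 : 0 ≤ ((N : ℝ) + 1) ^ (-a₂) := Real.rpow_nonneg hNpos.le _
    calc ((N : ℝ) + 1) ^ (-b) + (A₁ + D * (2 / κ ^ 2)) * ((N : ℝ) + 1) ^ (-p) +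
          D * (Real.exp (2 / κ ^ 2) * Real.exp (-(((N : ℝ) + 1) / κ)))
        ≤ ((N : ℝ) + 1) ^ (-a₂) + (A₁ + D * m) * ((N : ℝ) + 1) ^ (-a₂) +
          D * (Real.exp m * (κ * ((N : ℝ) + 1) ^ (-a₂))) := by rw [hm]; gcongr
      _ = K * ((N : ℝ) + 1) ^ (-a₂) := by rw [hK]; ring
  -- assemble
  have hfinal : C * ((N : ℝ) + 1) ^ (1 - c) + ((N : ℝ) + 1) * (K * ((N : ℝ) + 1) ^ (-a₂)) ≤
      (max C 0 + K) * ((N : ℝ) + 1) ^ (1 - a₁) := by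
    have hc1 : ((N : ℝ) + 1) ^ (1 - c) ≤ ((N : ℝ) + 1) ^ (1 - a₁) :=
      Real.rpow_le_rpow_of_exponent_le hN1' (by linarith [min_le_right a₂ c])
    have hc2 : ((N : ℝ) + 1) * ((N : ℝ) + 1) ^ (-a₂) ≤ ((N : ℝ) + 1) ^ (1 - a₁) := by
      rw [show ((N : ℝ) + 1) * ((N : ℝ) + 1) ^ (-a₂) = ((N : ℝ) + 1) ^ (1 - a₂) by
        rw [sub_eq_add_neg, Real.rpow_add hNpos, Real.rpow_one]]
      exact Real.rpow_le_rpow_of_exponent_le hN1' (by linarith [min_le_left a₂ c])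
    have hC : C * ((N : ℝ) + 1) ^ (1 - c) ≤ max C 0 * ((N : ℝ) + 1) ^ (1 - a₁) :=
      (mul_le_mul_of_nonneg_right (le_max_left C 0) (Real.rpow_nonneg hNpos.le _)).trans
        (mul_le_mul_of_nonneg_left hc1 (le_max_right _ _))
    calc C * ((N : ℝ) + 1) ^ (1 - c) + ((N : ℝ) + 1) * (K * ((N : ℝ) + 1) ^ (-a₂))
        = C * ((N : ℝ) + 1) ^ (1 - c) + K * (((N : ℝ) + 1) * ((N : ℝ) + 1) ^ (-a₂)) := by ring
      _ ≤ max C 0 * ((N : ℝ) + 1) ^ (1 - a₁) + K * ((N : ℝ) + 1) ^ (1 - a₁) := by gcongr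
      _ = (max C 0 + K) * ((N : ℝ) + 1) ^ (1 - a₁) := by ring
  calc _ ≤ C * ((N : ℝ) + 1) ^ (1 - c) - ((N : ℝ) + 1) * ∫ z, linStat σ ρ θ u s ((Φ N).flow s z)
        ∂(localGibbsLaw σ a₀ u₀ θ₀ N (Φ N)) := h1
    _ ≤ C * ((N : ℝ) + 1) ^ (1 - c) + ((N : ℝ) + 1) * (K * ((N : ℝ) + 1) ^ (-a₂)) := by nlinarith [hmean, h3]
    _ ≤ (max C 0 + K) * ((N : ℝ) + 1) ^ (1 - a₁) := hfinal

end Summit.AtomisticToContinuum.HydrodynamicLimit.Theorems.FibreDeficitTransfer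

end
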